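import Summits.ResolutionOfSingularities.ResolutionOfSingularities.Theorems.DeltaCutMirrorTransport
import HarnessLib

/-!
# DeltaCutMirrorTransport2 — the TRANSPORT FILE, part 2 (§T4–§T6)

Tree slice 2/2 of the HOME file
`run/shared/lean/pub/decomp-res/decomp-res-lens-6/g29/transport/MirrorTransport.lean` (verbatim §T4–§T6).
§T4 closed-subset data (`DimLEOne`, `ReducedRegular`, `surfacePart`) and the graded hop's firing test / centre along
isomorphisms; §T5 the
pending phase's data (`singLocusOf`, `singCentreOf`, exit centre); §T6 the currency `RefStageIso` (isomorphisms of
refined stages) with the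
g27/g28 hops' tests and centres carried along it.  TOOL, landable at 0 (row 218).  No `sorry`, no new axiom, no
instance, no notation.
[new; elementary] [folklore]
-/

noncomputable section

open CategoryTheory CategoryTheory.Limits AlgebraicGeometry TopologicalSpace IsLocalRing
open Literature.AlgebraicGeometry.Resolution

universe u

namespace Summit.ResolutionOfSingularities.ResolutionOfSingularities.Theorems.DeltaCutClasses

open Summit.ResolutionOfSingularities.ResolutionOfSingularities.Theorems.TwistCutClasses
open Summit.ResolutionOfSingularities.ResolutionOfSingularities.Theorems.LightCutClasses
open Summit.ResolutionOfSingularities.ResolutionOfSingularities.Theorems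
open WeakOrderReduction ForcedTowerClasses SubfieldContactClasses AbsoluteContactClasses PurityValveClasses

section MTransportClosed

open Scheme.IdealSheafData (vanishingIdeal)

variable {X Y : Scheme.{0}}

/-! #### §T4 — closed-subset data (`DimLEOne`, `ReducedRegular`, `surfacePart`) and the GRADED HOP's firing test and centre
(`SurfaceRegular`, `TopFrozen`, `CurveFrozen`, `surfacePart (badClosure n N)`) along ISOMORPHISMS -/

/-- the topological Krull dimension of a subset is invariant under an isomorphism of schemes (preimage form). [folklore] -/
theorem topologicalKrullDim_preimage_of_isIso (f : X ⟶ Y) [IsIso f] (Z : Set Y) :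
    topologicalKrullDim (f.base ⁻¹' Z) = topologicalKrullDim Z :=
  IsHomeomorph.topologicalKrullDim_eq _
    ((Scheme.homeoOfIso (asIso f)).subtype (p := fun x => x ∈ f.base ⁻¹' Z) (q := fun y => y ∈ Z) fun _ => Iff.rfl).isHomeomorph

/-- the topological Krull dimension of a subset is invariant under an isomorphism of schemes (image form). [folklore] -/
theorem topologicalKrullDim_image_of_isIso (f : X ⟶ Y) [IsIso f] (Z : Set X) :
    topologicalKrullDim (f.base '' Z) = topologicalKrullDim Z :=
  (IsHomeomorph.topologicalKrullDim_eq _ ((Scheme.homeoOfIso (asIso f)).image Z).isHomeomorph).symm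

/-- `DimLEOne` along an isomorphism. [new] [folklore] -/
theorem dimLEOne_preimage_iff_of_isIso (f : X ⟶ Y) [IsIso f] (S : TopologicalSpace.Closeds Y) :
    DimLEOne (S.preimage f.base.hom.continuous) ↔ DimLEOne S := by
  unfold DimLEOne
  rw [topologicalKrullDim_subscheme_vanishingIdeal, topologicalKrullDim_subscheme_vanishingIdeal,
    TopologicalSpace.Closeds.coe_preimage, topologicalKrullDim_preimage_of_isIso]

/-- the reduced ideal of a closed subset pulls back along an isomorphism to the reduced ideal of the preimage (the tree's
`vanishingIdeal_comap_hom`, restated for a morphism with `IsIso`). [folklore] -/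
theorem vanishingIdeal_comap_of_isIso (f : X ⟶ Y) [IsIso f] (S : TopologicalSpace.Closeds Y) :
    (vanishingIdeal S).comap f = vanishingIdeal (S.preimage f.base.hom.continuous) :=
  vanishingIdeal_comap_hom (asIso f) S

/-- `ReducedRegular` along an isomorphism (locally Noetherian). [new] [folklore] -/
theorem reducedRegular_preimage_iff_of_isIso (f : X ⟶ Y) [IsIso f] [IsLocallyNoetherian X] [IsLocallyNoetherian Y]
    (S : TopologicalSpace.Closeds Y) : ReducedRegular (S.preimage f.base.hom.continuous) ↔ ReducedRegular S := by
  unfold ReducedRegular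
  rw [← vanishingIdeal_comap_of_isIso]
  exact isRegular_subscheme_comap_iff_of_isIso f _

/-- the defining family of the surface part corresponds under an isomorphism: preimage direction. [folklore] -/
theorem surfaceFamily_preimage_of_isIso (f : X ⟶ Y) [IsIso f] (S : TopologicalSpace.Closeds Y) {Z : Set Y}
    (hZ : IsIrreducible Z ∧ IsClosed Z ∧ Z ⊆ (S : Set Y) ∧ ¬ topologicalKrullDim Z ≤ 1) :
    IsIrreducible (f.base ⁻¹' Z) ∧ IsClosed (f.base ⁻¹' Z) ∧ f.base ⁻¹' Z ⊆ (S.preimage f.base.hom.continuous : Set X) ∧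
      ¬ topologicalKrullDim (f.base ⁻¹' Z) ≤ 1 := by
  obtain ⟨h1, h2, h3, h4⟩ := hZ
  refine ⟨?_, h2.preimage f.base.hom.continuous, ?_, by rwa [topologicalKrullDim_preimage_of_isIso]⟩
  · have : f.base ⁻¹' Z = (Scheme.homeoOfIso (asIso f)).symm '' Z := by
      rw [Homeomorph.image_symm]; rfl
    rw [this]
    exact h1.image _ (Scheme.homeoOfIso (asIso f)).symm.continuous.continuousOn
  · rw [TopologicalSpace.Closeds.coe_preimage]; exact Set.preimage_mono h3

/-- the defining family of the surface part corresponds under an isomorphism: image direction. [folklore] -/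
theorem surfaceFamily_image_of_isIso (f : X ⟶ Y) [IsIso f] (S : TopologicalSpace.Closeds Y) {Z : Set X}
    (hZ : IsIrreducible Z ∧ IsClosed Z ∧ Z ⊆ (S.preimage f.base.hom.continuous : Set X) ∧ ¬ topologicalKrullDim Z ≤ 1) :
    IsIrreducible (f.base '' Z) ∧ IsClosed (f.base '' Z) ∧ f.base '' Z ⊆ (S : Set Y) ∧ ¬ topologicalKrullDim (f.base '' Z) ≤ 1 := by
  obtain ⟨h1, h2, h3, h4⟩ := hZ
  refine ⟨h1.image _ f.base.hom.continuous.continuousOn, (Scheme.homeoOfIso (asIso f)).isClosed_image.mpr h2, ?_,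
    by rwa [topologicalKrullDim_image_of_isIso]⟩
  rw [TopologicalSpace.Closeds.coe_preimage] at h3
  exact Set.image_subset_iff.mpr h3

/-- **THE SURFACE PART IS EQUIVARIANT**: along an isomorphism, `surfacePart (f⁻¹ S) = f⁻¹ (surfacePart S)`. [new] [folklore] -/
theorem surfacePart_preimage_of_isIso (f : X ⟶ Y) [IsIso f] (S : TopologicalSpace.Closeds Y) :
    surfacePart (S.preimage f.base.hom.continuous) = (surfacePart S).preimage f.base.hom.continuous := by
  apply TopologicalSpace.Closeds.ext
  simp only [surfacePart, TopologicalSpace.Closeds.coe_mk, TopologicalSpace.Closeds.coe_preimage]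
  rw [f.isOpenEmbedding.isOpenMap.preimage_closure_eq_closure_preimage f.base.hom.continuous]
  congr 1
  ext x
  simp only [Set.mem_sUnion, Set.mem_setOf_eq, Set.mem_preimage]
  constructor
  · rintro ⟨Z, hZ, hx⟩
    have hZ' : IsIrreducible Z ∧ IsClosed Z ∧ Z ⊆ (S.preimage f.base.hom.continuous : Set X) ∧ ¬ topologicalKrullDim Z ≤ 1 := by
      rw [TopologicalSpace.Closeds.coe_preimage]; exact hZ
    exact ⟨f.base '' Z, surfaceFamily_image_of_isIso f S hZ', Set.mem_image_of_mem _ hx⟩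
  · rintro ⟨Z, hZ, hx⟩
    have h := surfaceFamily_preimage_of_isIso f S hZ
    rw [TopologicalSpace.Closeds.coe_preimage] at h
    exact ⟨f.base ⁻¹' Z, h, hx⟩

/-- **THE GRADED CENTRE IS EQUIVARIANT** (as a closed subset): along an isomorphism,
`surfacePart (badClosure n ⟨X, I.comap f⟩) = f⁻¹ (surfacePart (badClosure n ⟨Y, I⟩))`. [new] [folklore] -/
theorem surfacePart_badClosure_comap_of_isIso (f : X ⟶ Y) [IsIso f] (I : Y.IdealSheafData) (n : ℕ) :
    surfacePart (badClosure n ⟨X, I.comap f⟩) = (surfacePart (badClosure n ⟨Y, I⟩)).preimage f.base.hom.continuous := by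
  rw [badClosure_comap_of_isIso, surfacePart_preimage_of_isIso]

/-- **THE GRADED CENTRE IS EQUIVARIANT** (as the reduced ideal that `gHop` blows up): along an isomorphism,
`(𝓘 (surfacePart (badClosure n ⟨Y, I⟩))).comap f = 𝓘 (surfacePart (badClosure n ⟨X, I.comap f⟩))`. [new] [folklore] -/
theorem gradedCentre_comap_of_isIso (f : X ⟶ Y) [IsIso f] (I : Y.IdealSheafData) (n : ℕ) :
    (vanishingIdeal (surfacePart (badClosure n ⟨Y, I⟩))).comap f = vanishingIdeal (surfacePart (badClosure n ⟨X, I.comap f⟩)) := by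
  rw [vanishingIdeal_comap_of_isIso, surfacePart_badClosure_comap_of_isIso]

/-- `SurfaceRegular` along an isomorphism. [new] [folklore] -/
theorem surfaceRegular_comap_iff_of_isIso (f : X ⟶ Y) [IsIso f] [IsLocallyNoetherian X] [IsLocallyNoetherian Y]
    (I : Y.IdealSheafData) (n : ℕ) : SurfaceRegular n ⟨X, I.comap f⟩ ↔ SurfaceRegular n ⟨Y, I⟩ := by
  unfold SurfaceRegular
  rw [surfacePart_badClosure_comap_of_isIso, reducedRegular_preimage_iff_of_isIso]

/-- `CurveFrozen` (g26's F-curve letter) along an isomorphism. [new] [folklore] -/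
theorem curveFrozen_comap_iff_of_isIso (f : X ⟶ Y) [IsIso f] [IsLocallyNoetherian X] [IsLocallyNoetherian Y]
    (I : Y.IdealSheafData) (n : ℕ) : CurveFrozen n ⟨X, I.comap f⟩ ↔ CurveFrozen n ⟨Y, I⟩ := by
  unfold CurveFrozen
  rw [badEmpty_comap_iff_of_isIso, closureRegular_comap_iff_of_isIso, badClosure_comap_of_isIso, dimLEOne_preimage_iff_of_isIso]

/-- **THE GRADED HOP's FIRING TEST IS EQUIVARIANT**: `TopFrozen n ⟨X, I.comap f⟩ ↔ TopFrozen n ⟨Y, I⟩` along an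
isomorphism. [new]
[folklore] -/
theorem topFrozen_comap_iff_of_isIso (f : X ⟶ Y) [IsIso f] [IsLocallyNoetherian X] [IsLocallyNoetherian Y]
    (I : Y.IdealSheafData) (n : ℕ) : TopFrozen n ⟨X, I.comap f⟩ ↔ TopFrozen n ⟨Y, I⟩ := by
  unfold TopFrozen
  rw [badEmpty_comap_iff_of_isIso, closureRegular_comap_iff_of_isIso, badClosure_comap_of_isIso, dimLEOne_preimage_iff_of_isIso,
    surfaceRegular_comap_iff_of_isIso]

end MTransportClosed

section MTransportPending

open Scheme.IdealSheafData (vanishingIdeal)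

variable {X Y : Scheme.{0}}

/-! #### §T5 — the PENDING PHASE's data (`singLocusOf`, `singCentreOf`, the resolve centre) along ISOMORPHISMS -/

/-- regularity of the local ring is invariant along an invertible stalk map. [folklore] -/
theorem mem_regularLocus_iff_of_isIso_stalkMap (g : X ⟶ Y) (x : X) [IsIso (g.stalkMap x)] :
    x ∈ Scheme.regularLocus X ↔ g.base x ∈ Scheme.regularLocus Y := by
  simp only [Scheme.mem_regularLocus]
  let e : Y.presheaf.stalk (g.base x) ≃+* X.presheaf.stalk x := (asIso (g.stalkMap x)).commRingCatIsoToRingEquiv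
  exact ⟨fun _ => IsRegularLocalRing.of_ringEquiv e.symm, fun _ => IsRegularLocalRing.of_ringEquiv e⟩

/-- the singular locus of the closed subscheme of an ideal sheaf, read in the ambient scheme (so that `singLocusOf
S` is this for
`𝓘 S`, by `rfl`). DEFINITION (support, local to this file). -/
def singLocusOfIdeal (J : Y.IdealSheafData) : Set Y := J.subschemeι.base '' (Scheme.regularLocus J.subscheme)ᶜ

/-- `singLocusOf S = singLocusOfIdeal (𝓘 S)`. [folklore] -/
theorem singLocusOf_eq (S : TopologicalSpace.Closeds Y) : singLocusOf S = singLocusOfIdeal (vanishingIdeal S) := rfl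

/-- the comparison morphism of closed subschemes `V(J.comap f) ⟶ V(J)` over `f`. DEFINITION (support, local). -/
def subschemeComap (f : X ⟶ Y) (J : Y.IdealSheafData) : (J.comap f).subscheme ⟶ J.subscheme :=
  Scheme.IdealSheafData.subschemeMap _ _ f (J.le_map_comap f)

/-- the comparison morphism lies over `f`. [folklore] -/
theorem subschemeComap_ι (f : X ⟶ Y) (J : Y.IdealSheafData) :
    subschemeComap f J ≫ J.subschemeι = (J.comap f).subschemeι ≫ f :=
  Scheme.IdealSheafData.subschemeMap_subschemeι _ _ _ _

/-- along an ISOMORPHISM the comparison morphism of closed subschemes is an isomorphism. [folklore] -/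
theorem isIso_subschemeComap (f : X ⟶ Y) [IsIso f] (J : Y.IdealSheafData) : IsIso (subschemeComap f J) := by
  have h : subschemeComap f J = (J.comapIso f).hom ≫ pullback.snd f J.subschemeι :=
    (Scheme.IdealSheafData.comapIso_hom_snd J f).symm
  rw [h]
  infer_instance

/-- **THE SINGULAR LOCUS OF A CLOSED SUBSCHEME IS EQUIVARIANT**: along an isomorphism `f`,
`singLocusOfIdeal (J.comap f) = f ⁻¹' singLocusOfIdeal J`. [new] [folklore] -/
theorem singLocusOfIdeal_comap_of_isIso (f : X ⟶ Y) [IsIso f] (J : Y.IdealSheafData) :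
    singLocusOfIdeal (J.comap f) = f.base ⁻¹' singLocusOfIdeal J := by
  haveI := isIso_subschemeComap f J
  set g := subschemeComap f J with hg
  have hgι : ∀ z, J.subschemeι.base (g.base z) = f.base ((J.comap f).subschemeι.base z) := fun z => by
    change (g ≫ J.subschemeι).base z = ((J.comap f).subschemeι ≫ f).base z
    rw [subschemeComap_ι]
  ext x
  simp only [singLocusOfIdeal, Set.mem_image, Set.mem_preimage, Set.mem_compl_iff]
  constructor
  · rintro ⟨z, hz, rfl⟩
    refine ⟨g.base z, fun h => hz ((mem_regularLocus_iff_of_isIso_stalkMap g z).mpr h), hgι z⟩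
  · rintro ⟨z, hz, hzx⟩
    have e : g.base ((inv g).base z) = z := by
      change (inv g ≫ g).base z = z
      rw [IsIso.inv_hom_id]; rfl
    refine ⟨(inv g).base z, fun h => hz ?_, ?_⟩
    · have h' := (mem_regularLocus_iff_of_isIso_stalkMap g ((inv g).base z)).mp h
      rwa [e] at h'
    · have e1 : f.base ((J.comap f).subschemeι.base ((inv g).base z)) = f.base x := by rw [← hgι, e, hzx]
      exact (Scheme.homeoOfIso (asIso f)).injective e1

/-- **`singLocusOf` IS EQUIVARIANT**: along an isomorphism, `singLocusOf (f⁻¹ S) = f ⁻¹' singLocusOf S`. [new] [folklore] -/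
theorem singLocusOf_preimage_of_isIso (f : X ⟶ Y) [IsIso f] (S : TopologicalSpace.Closeds Y) :
    singLocusOf (S.preimage f.base.hom.continuous) = f.base ⁻¹' singLocusOf S := by
  rw [singLocusOf_eq, singLocusOf_eq, ← vanishingIdeal_comap_of_isIso, singLocusOfIdeal_comap_of_isIso]

/-- the closure of the singular locus along an isomorphism. [folklore] -/
theorem closure_singLocusOf_preimage_of_isIso (f : X ⟶ Y) [IsIso f] (S : TopologicalSpace.Closeds Y) :
    closure (singLocusOf (S.preimage f.base.hom.continuous)) = f.base ⁻¹' closure (singLocusOf S) := by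
  rw [singLocusOf_preimage_of_isIso, f.isOpenEmbedding.isOpenMap.preimage_closure_eq_closure_preimage f.base.hom.continuous]

/-- **THE RESOLVING CENTRE IS EQUIVARIANT**: along an isomorphism, `(singCentreOf S).comap f = singCentreOf (f⁻¹ S)`
— the reduced
closure of `Sing S_red` pulls back to the reduced closure of `Sing (f⁻¹S)_red`. [new] [folklore] -/
theorem singCentreOf_comap_of_isIso (f : X ⟶ Y) [IsIso f] (S : TopologicalSpace.Closeds Y) :
    (singCentreOf S).comap f = singCentreOf (S.preimage f.base.hom.continuous) := by
  unfold singCentreOf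
  rw [vanishingIdeal_comap_of_isIso]
  congr 1
  apply TopologicalSpace.Closeds.ext
  simp only [TopologicalSpace.Closeds.coe_preimage, TopologicalSpace.Closeds.coe_mk]
  exact (closure_singLocusOf_preimage_of_isIso f S).symm

/-- **THE EXIT CENTRE IS EQUIVARIANT**: along an isomorphism, `(𝓘 S).comap f = 𝓘 (f⁻¹ S)` (the centre `RefStage.exit` blows up).
[folklore] -/
theorem exitCentre_comap_of_isIso (f : X ⟶ Y) [IsIso f] (S : TopologicalSpace.Closeds Y) :
    (vanishingIdeal S).comap f = vanishingIdeal (S.preimage f.base.hom.continuous) :=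
  vanishingIdeal_comap_of_isIso f S

/-- **`refHop`'s BRANCH TESTS ARE EQUIVARIANT** (pending phase: `ReducedRegular`; no pending phase: `CurveFrozen`,
then `SepActive`) —
collected: along an isomorphism of locally Noetherian stages every test letter of g27's refined hop and of g28's
graded hop agrees on
corresponding data. [new] [folklore] -/
theorem refTests_iff_of_isIso (f : X ⟶ Y) [IsIso f] [IsLocallyNoetherian X] [IsLocallyNoetherian Y] (I : Y.IdealSheafData) (n : ℕ)
    (S : TopologicalSpace.Closeds Y) :
    (ReducedRegular (S.preimage f.base.hom.continuous) ↔ ReducedRegular S) ∧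
      (CurveFrozen n ⟨X, I.comap f⟩ ↔ CurveFrozen n ⟨Y, I⟩) ∧ (SepActive n ⟨X, I.comap f⟩ ↔ SepActive n ⟨Y, I⟩) ∧
      (TopFrozen n ⟨X, I.comap f⟩ ↔ TopFrozen n ⟨Y, I⟩) :=
  ⟨reducedRegular_preimage_iff_of_isIso f S, curveFrozen_comap_iff_of_isIso f I n, sepActive_comap_iff_of_isIso f I n,
    topFrozen_comap_iff_of_isIso f I n⟩

end MTransportPending

section MTransportRef

open Scheme.IdealSheafData (vanishingIdeal)

/-! #### §T6 — a CURRENCY for (T-a): isomorphisms of REFINED STAGES (base isomorphism carrying the ideal by `comap`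
and the pending
closed subset by preimage), and the g27/g28 hops' TESTS and CENTRES along them -/

/-- **AN ISOMORPHISM OF REFINED STAGES** `R' ≅ R`: an isomorphism of the underlying schemes along which the ideal of
`R` pulls back to
the ideal of `R'` and the pending closed subset of `R` to that of `R'`. DEFINITION (support; proposed (T-a) currency
— a structure with
data, no axioms smuggled: all three fields are checkable equalities). -/
structure RefStageIso (R R' : RefStage) where
  /-- the isomorphism of schemes -/
  iso : R'.base.Y ≅ R.base.Y
  /-- the ideal is carried: `𝓘' = φ⁻¹ 𝓘` -/
  ideal : R'.base.I = R.base.I.comap iso.hom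
  /-- the memory is carried: `pending' = φ⁻¹ pending` -/
  pending : R'.pending = R.pending.map fun S => S.preimage iso.hom.base.hom.continuous

namespace RefStageIso

variable {R R' : RefStage} (φ : RefStageIso R R') (n : ℕ)

/-- the base stage of `R'` IS the pulled-back stage. [folklore] -/
theorem base_eq : R'.base = ⟨R'.base.Y, R.base.I.comap φ.iso.hom⟩ := by
  rw [← φ.ideal]

include φ

/-- `BadEmpty` agrees along an isomorphism of refined stages. [new] [folklore] -/
theorem badEmpty_iff : BadEmpty n R'.base ↔ BadEmpty n R.base := by
  rw [φ.base_eq]; exact badEmpty_comap_iff_of_isIso φ.iso.hom R.base.I n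

variable [IsLocallyNoetherian R.base.Y] [IsLocallyNoetherian R'.base.Y]

/-- `TopFrozen` (g28's firing test) agrees along an isomorphism of refined stages. [new] [folklore] -/
theorem topFrozen_iff : TopFrozen n R'.base ↔ TopFrozen n R.base := by
  rw [φ.base_eq]; exact topFrozen_comap_iff_of_isIso φ.iso.hom R.base.I n

/-- `CurveFrozen` agrees along an isomorphism of refined stages. [new] [folklore] -/
theorem curveFrozen_iff : CurveFrozen n R'.base ↔ CurveFrozen n R.base := by
  rw [φ.base_eq]; exact curveFrozen_comap_iff_of_isIso φ.iso.hom R.base.I n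

/-- `SepActive` agrees along an isomorphism of refined stages. [new] [folklore] -/
theorem sepActive_iff : SepActive n R'.base ↔ SepActive n R.base := by
  rw [φ.base_eq]; exact sepActive_comap_iff_of_isIso φ.iso.hom R.base.I n

/-- **`GradeNow` (the graded hop's branch) agrees along an isomorphism of refined stages.** [new] [folklore] -/
theorem gradeNow_iff : GradeNow n R' ↔ GradeNow n R := by
  unfold GradeNow
  rw [φ.topFrozen_iff, φ.pending]
  cases R.pending <;> simp

omit [IsLocallyNoetherian R.base.Y] [IsLocallyNoetherian R'.base.Y] in
/-- **the GRADED CENTRE is carried**: `φ⁻¹ 𝓘(surfacePart (badClosure n R)) = 𝓘(surfacePart (badClosure n R'))`.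
[new] [folklore] -/
theorem gradedCentre_comap :
    (vanishingIdeal (surfacePart (badClosure n R.base))).comap φ.iso.hom =
      vanishingIdeal (surfacePart (badClosure n (⟨R'.base.Y, R.base.I.comap φ.iso.hom⟩ : Stage))) :=
  gradedCentre_comap_of_isIso φ.iso.hom R.base.I n

omit [IsLocallyNoetherian R.base.Y] [IsLocallyNoetherian R'.base.Y] in
/-- **the STEP-1 CENTRE is carried**: `φ⁻¹ (badClosureCentre n R) = badClosureCentre n R'`. [new] [folklore] -/
theorem stepOneCentre_comap :
    (badClosureCentre n R.base).comap φ.iso.hom = badClosureCentre n (⟨R'.base.Y, R.base.I.comap φ.iso.hom⟩ : Stage) :=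
  badClosureCentre_comap_of_isIso φ.iso.hom R.base.I n

omit [IsLocallyNoetherian R.base.Y] [IsLocallyNoetherian R'.base.Y] in
/-- **the RESOLVING CENTRE of a pending `S` is carried**: `φ⁻¹ (singCentreOf S) = singCentreOf (φ⁻¹ S)`. [new] [folklore] -/
theorem singCentre_comap (S : TopologicalSpace.Closeds R.base.Y) :
    (singCentreOf S).comap φ.iso.hom = singCentreOf (S.preimage φ.iso.hom.base.hom.continuous) :=
  singCentreOf_comap_of_isIso φ.iso.hom S

omit [IsLocallyNoetherian R.base.Y] [IsLocallyNoetherian R'.base.Y] in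
/-- **the EXIT CENTRE of a pending `S` is carried**: `φ⁻¹ 𝓘(S) = 𝓘(φ⁻¹ S)`. [folklore] -/
theorem exitCentre_comap (S : TopologicalSpace.Closeds R.base.Y) :
    (vanishingIdeal S).comap φ.iso.hom = vanishingIdeal (S.preimage φ.iso.hom.base.hom.continuous) :=
  exitCentre_comap_of_isIso φ.iso.hom S

/-- the pending phase's EXIT TEST agrees: `ReducedRegular (φ⁻¹ S) ↔ ReducedRegular S`. [new] [folklore] -/
theorem reducedRegular_iff (S : TopologicalSpace.Closeds R.base.Y) :
    ReducedRegular (S.preimage φ.iso.hom.base.hom.continuous) ↔ ReducedRegular S :=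
  reducedRegular_preimage_iff_of_isIso φ.iso.hom S

end RefStageIso

/-- the identity isomorphism of a refined stage. DEFINITION (support). -/
def RefStageIso.refl (R : RefStage) : RefStageIso R R where
  iso := Iso.refl _
  ideal := by rw [Iso.refl_hom, Scheme.IdealSheafData.comap_id]
  pending := by
    cases h : R.pending with
    | none => rfl
    | some S => simp only [Option.map_some]; congr 1

end MTransportRef

end Summit.ResolutionOfSingularities.ResolutionOfSingularities.Theorems.DeltaCutClasses
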